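import Summits.PneNP.PneNP.Theses.SzkEntropy
import Summits.PneNP.PneNP.Theorems.SzkEntropyPeaThreeNotInP
import Summits.PneNP.PneNP.Theorems.SzkEntropyPeaThreeNotInPKillSwitch
import Summits.PneNP.PneNP.Theorems.SzkEntropyPeaThreeNotInPCoreStubReduction
import Summits.PneNP.PneNP.Theorems.SzkEntropyPeaWorstToAvg
import Summits.PneNP.PneNP.Theorems.PeaWorstToAvg.Negative.NotPeaWorstToAvgImpliesTarget
import Literature.Computability.Complexity.PolynomialEntropyApproximation
import Literature.Computability.Complexity.PEASigmaTwo
import Literature.Computability.Complexity.PromiseCookReductionsProofs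

/-!
# STRATEGY CENSUS for `PeaThreeNotInP` (stmt-PneNP-10776) — Lean side (crux-strategist, unit
`cstrat-stmt-PneNP-10776-r1`, 2026-08-17)

Companion of `Cruxes/PeaThreeNotInP/STRATEGY-CENSUS.md (Lean companions: StrategyCensusObstructions.lean, StrategyCensusProbes.lean)`.  X := `SzkEntropy.PeaThreeNotInP`
(`PEA 3 ∉ PromiseP`), S := `PneNP`.  The BC2-redirect exemption asks for OPEN pieces
`X₁ … X_k` (k ≥ 2) with a PROVED, NON-TRIVIAL assembly `X₁ → … → X_k → X` and NO piece `≥ X` or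
`≥ S`.  The theorems below are the kernel-checked obstructions the census invokes; nothing here is
conjectural and nothing uses `sorry`.

* §O0  `X → S` unconditionally (the route's `closes` with its three PROVED supports), so every
        conjunction of pieces that yields X yields S.
* §O1  HARDNESS-IMPORT SHAPE `X ⇐ (Q ∉ PromiseP) ∧ (Q ≤ PEA 3)`: as soon as the reduction piece is
        a theorem, the hardness piece ALONE gives X and S (Cook or Karp; sub-promises included) —
        clause (c) fails for the hardness piece, clause (a) for everything else.  This is exactly
        the verdict PIECE-EQUIVALENT on line SketchIdeator3 (`Q = TensorIsoFull`, §O4).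
        §O1': any promise problem inside promise-`PH` and outside promise-`P` already gives S.
* §O2  THE `¬S`-CONSEQUENCE LEMMA: in a two-piece decomposition `A → B → X`, if `¬S → A` is a
        theorem then `B → S` is a theorem.  Hence no piece may be a consequence of `P = NP`:
        consequence-side statements (`PeaWorstToAvg`, OWF-from-SZK-hardness, …) and kill-side
        statements (`PeaThreeMemBPP`) force their partner to be summit-strength.
        §O2': a piece implied by `¬X` (every consequence-side statement) is not even
        load-bearing — its partner alone proves X.
* §O3  The modus-ponens seam `W → (W → X) → X` is one line: every "restricted-model lower bound W
        + simulation `PEA 3 ∈ P → PEA 3 ∈ 𝓜`" split is cut along a trivial seam (clause (b)) unless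
        the simulation is itself DERIVED from a structural theorem about `PEA 3` (hardness
        magnification) — none exists (census §Decomposition D4–D6).
* §O4  Probes for the line's open piece C⁺ = `TensorIsoFull ∉ PromiseP`: `C⁺ → S` and `C⁺ → X`
        are closed by NAMED tree theorems (what `exact?` returns), i.e. clause (c) fails.
* §O5  AVERAGE-CASE pieces are `≥ X`: `((PEA 3).yes, D) ∉ HeurBPP` for a promise-supported `D`
        gives `PEA 3 ∉ PromiseBPP'`, hence X (two landed lemmas).
-/

namespace Summit.PneNP.PneNP.Cruxes.PeaThreeNotInP.StrategyCensus

set_option linter.dupNamespace false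

open Literature.Computability.Complexity Literature.Computability.MetaComplexity
open _root_.Computability
open Summit.PneNP.PneNP.Theses.SzkEntropy Summit.PneNP.PneNP.Theorems
open Summit.PneNP.PneNP.Cruxes.PeaThreeNotInP.TensorIsoLine

/-! ### §O0  X is at least the summit -/

/-- `X → S`: the route's certified deciding theorem with its three proved supports discharged. -/
theorem pneNP_of_peaThreeNotInP (hX : PeaThreeNotInP) : _root_.PneNP :=
  closes hX PeaMemPH_holds PhCollapse_holds CookModelBridge_holds

/-! ### §O1  Hardness-import decompositions: the hardness piece alone is `≥ X` and `≥ S` -/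

/-- Cook-import: if `Q` Cook-reduces to `PEA 3`, the piece `Q ∉ PromiseP` alone gives X. -/
theorem peaThreeNotInP_of_cookImport {Q : PromiseProblem}
    (hred : Q.CookReducible (PEA 3)) (hhard : Q ∉ PromiseP) : PeaThreeNotInP :=
  szkEntropy_peaThreeNotInP_iff.2 fun h3 =>
    hhard (PromiseProblem.mem_PromiseP_of_cookReducible_holds Q (PEA 3) hred h3)

/-- Karp-import: if `Q ≤ₚ PEA 3`, the piece `Q ∉ PromiseP` alone gives X. -/
theorem peaThreeNotInP_of_karpImport {Q : PromiseProblem}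
    (hred : Q.PolyTimeReducible (PEA 3)) (hhard : Q ∉ PromiseP) : PeaThreeNotInP :=
  peaThreeNotInP_of_cookImport hred.cookReducible hhard

/-- … and alone gives the summit. -/
theorem pneNP_of_cookImport {Q : PromiseProblem}
    (hred : Q.CookReducible (PEA 3)) (hhard : Q ∉ PromiseP) : _root_.PneNP :=
  pneNP_of_peaThreeNotInP (peaThreeNotInP_of_cookImport hred hhard)

/-- … Karp form. -/
theorem pneNP_of_karpImport {Q : PromiseProblem}
    (hred : Q.PolyTimeReducible (PEA 3)) (hhard : Q ∉ PromiseP) : _root_.PneNP :=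
  pneNP_of_peaThreeNotInP (peaThreeNotInP_of_karpImport hred hhard)

/-- Sub-promise pieces (instance families): hardness of ANY sub-promise problem of `PEA 3`
(`Q.yes ≤ (PEA 3).yes`, `Q.no ≤ (PEA 3).no`, e.g. `INJ-vs-2TO1₃`, a planted family, a threshold
slice) alone gives X — restricting the promise only makes the problem easier. -/
theorem peaThreeNotInP_of_subPromise {Q : PromiseProblem}
    (hy : Q.yes ≤ (PEA 3).yes) (hn : Q.no ≤ (PEA 3).no) (hhard : Q ∉ PromiseP) : PeaThreeNotInP :=
  szkEntropy_peaThreeNotInP_iff.2 fun ⟨L, hL, hyes, hno⟩ =>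
    hhard ⟨L, hL, hy.trans hyes, hn.trans hno⟩

/-- §O1': any promise problem in promise-`PH` that is outside promise-`P` gives the summit (the
collapse behind `closes`, with `Q` in place of `PEA 3`).  So a hardness piece is "strictly below
S" only for a problem NOT known to lie in promise-`PH`; but a problem that reduces to `PEA 3`
(which is in promise-`PH`, `PEAHash.PEA_mem_promiseLift_PH`) is morally in promise-`PH` itself, and
certainly its hardness gives S through §O1. -/
theorem pneNP_of_promisePH_not_mem_PromiseP {Q : PromiseProblem}
    (hQ : Q ∈ promiseLift PH) (hhard : Q ∉ PromiseP) : _root_.PneNP := by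
  by_contra hne
  refine hhard (promiseLift_mono (PhCollapse_holds ?_) hQ)
  intro L hL
  by_contra hLP
  exact hne ⟨L, CookModelBridge_holds.2 ▸ hL, fun h => hLP (CookModelBridge_holds.1 ▸ h)⟩

/-- Sanity instance of §O1': `PEA d ∉ PromiseP` gives S for every degree `d` (not only `d = 3`). -/
example (d : ℕ) (h : PEA d ∉ PromiseP) : _root_.PneNP :=
  pneNP_of_promisePH_not_mem_PromiseP (PEAHash.PEA_mem_promiseLift_PH d) h

/-! ### §O2  The `¬S`-consequence lemma -/

/-- **Propositional core.** If `X → S`, the assembly `A → B → X` is proved, and `A` is a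
consequence of `¬S`, then `B` alone implies `S`. -/
theorem piece_ge_summit_of_coPiece {S X A B : Prop}
    (hXS : X → S) (hasm : A → B → X) (hA : ¬ S → A) : B → S :=
  fun hB => Classical.byContradiction fun hS => hS (hXS (hasm (hA hS) hB))

/-- Instantiated at `X = PeaThreeNotInP`, `S = PneNP`: in any two-piece decomposition of X whose
first piece follows from `P = NP`, the second piece is summit-strength. -/
theorem piece_ge_pneNP_of_coPiece {A B : Prop}
    (hasm : A → B → PeaThreeNotInP) (hA : ¬ _root_.PneNP → A) : B → _root_.PneNP :=
  piece_ge_summit_of_coPiece pneNP_of_peaThreeNotInP hasm hA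

/-- `P = NP` refutes X … -/
theorem not_peaThreeNotInP_of_not_pneNP (h : ¬ _root_.PneNP) : ¬ PeaThreeNotInP :=
  fun hX => h (pneNP_of_peaThreeNotInP hX)

/-- … hence makes the consequence-side item `PeaWorstToAvg` TRUE (landed disjunction
`PeaWorstToAvg ∨ X`): `PeaWorstToAvg` is a `¬S`-consequence, so by §O2 its partner in any split
`PeaWorstToAvg → B → X` is `≥ S`. -/
theorem peaWorstToAvg_of_not_pneNP (h : ¬ _root_.PneNP) : PeaWorstToAvg :=
  (szkEntropy_peaWorstToAvg_or_peaThreeNotInP).resolve_right (not_peaThreeNotInP_of_not_pneNP h)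

/-- … and makes the kill switch `PeaThreeMemBPP` TRUE (landed `X ∨ PeaThreeMemBPP`). -/
theorem peaThreeMemBPP_of_not_pneNP (h : ¬ _root_.PneNP) : PeaThreeMemBPP :=
  (szkEntropy_peaThreeNotInP_or_peaThreeMemBPP).resolve_left (not_peaThreeNotInP_of_not_pneNP h)

/-- Worked instance of §O2: whatever `B` completes `PeaWorstToAvg` to X is summit-strength. -/
theorem partner_of_peaWorstToAvg_ge_pneNP {B : Prop} (hasm : PeaWorstToAvg → B → PeaThreeNotInP) :
    B → _root_.PneNP :=
  piece_ge_pneNP_of_coPiece hasm peaWorstToAvg_of_not_pneNP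

/-- **§O2' (sharper, for consequences of `¬X` itself).** A piece implied by `¬X` is never
load-bearing: its partner alone already gives X (clause (a) fails for `A`, clause (c) for `B`).
Every "hardness ⟹ more hardness" statement whose antecedent `¬X` refutes (worst-case → average-case,
SZK-hardness → OWF/PRG, `PeaWorstToAvg`) is of this kind. -/
theorem partner_ge_X_of_notX_consequence {X A B : Prop} (hasm : A → B → X) (hA : ¬ X → A) : B → X :=
  fun hB => Classical.byContradiction fun hX => hX (hasm (hA hX) hB)

/-- `¬X` makes `PeaWorstToAvg` true (its antecedent `PEA 3 ∉ PromiseBPP'` fails), … -/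
theorem peaWorstToAvg_of_not_peaThreeNotInP (h : ¬ PeaThreeNotInP) : PeaWorstToAvg :=
  (szkEntropy_peaWorstToAvg_or_peaThreeNotInP).resolve_right h

/-- … so in ANY split `PeaWorstToAvg → B → X` the partner `B` alone proves X. -/
theorem partner_of_peaWorstToAvg_ge_X {B : Prop} (hasm : PeaWorstToAvg → B → PeaThreeNotInP) :
    B → PeaThreeNotInP :=
  partner_ge_X_of_notX_consequence hasm peaWorstToAvg_of_not_peaThreeNotInP

/-! ### §O3  The modus-ponens seam (what clause (b) rejects) -/

/-- The entire assembly of a "weak lower bound `W` + simulation `W → X`" split: one line. -/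
theorem mp_seam {W : Prop} (hW : W) (hsim : W → PeaThreeNotInP) : PeaThreeNotInP :=
  hsim hW

/-- Contrapositive dress of the same seam ("`PEA 3 ∉ 𝓜` + `PEA 3 ∈ P → PEA 3 ∈ 𝓜`"): one line. -/
theorem mp_seam_model {M : Set PromiseProblem} (hW : PEA 3 ∉ M)
    (hsim : PEA 3 ∈ PromiseP → PEA 3 ∈ M) : PeaThreeNotInP :=
  szkEntropy_peaThreeNotInP_iff.2 fun h3 => hW (hsim h3)

/-! ### §O4  Probes for line SketchIdeator3's open piece C⁺ = `TensorIsoFull ∉ PromiseP` -/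

/-- Probe `C⁺ → S` SUCCEEDS by a named tree theorem (clause (c) fails). -/
example : TensorIsoFull ∉ PromiseP → _root_.PneNP := pneNP_of_tensorIsoFull

/-- Probe `C⁺ → X` SUCCEEDS by a named tree theorem (clause (c) fails; C⁺ is `≥ X`). -/
example : TensorIsoFull ∉ PromiseP → PeaThreeNotInP := peaThreeNotInP_of_tensorIsoFull

/-! ### §O5  Average-case pieces are `≥ X` -/

/-- A `HeurBPP`-hardness piece for `PEA 3` on ANY promise-supported ensemble alone gives X
(`mem_HeurBPP_of_mem_PromiseBPP'` + `PromiseP ⊆ PromiseBPP'` via the kill-switch lemma). -/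
theorem peaThreeNotInP_of_avgHard (D : Ensemble)
    (hD : ∀ n : ℕ, ∀ w ∈ (D n).support, w ∈ (PEA 3).yes ∨ w ∈ (PEA 3).no)
    (hhard : (⟨(PEA 3).yes, D⟩ : DistProblem) ∉ HeurBPP) : PeaThreeNotInP :=
  szkEntropy_peaThreeNotInP_of_not_peaThreeMemBPP fun hB =>
    hhard (mem_HeurBPP_of_mem_PromiseBPP' (PEA_disjoint 3) (szkEntropy_peaThreeMemBPP_iff.1 hB) D hD)

end Summit.PneNP.PneNP.Cruxes.PeaThreeNotInP.StrategyCensus
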